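import Mathlib
import Summits.Ventures.PercRepro2.Defs
import Summits.Ventures.PercRepro2.Graph
import Summits.Ventures.PercRepro2.OneColourSwitch
import Summits.Ventures.PercRepro2.RegionHubSign
import Summits.Ventures.PercRepro2.SideSwitch
import Summits.Ventures.PercRepro2.TermSwitchDefs
import Summits.Ventures.PercRepro2.TermSwitchReach
import Summits.Ventures.PercRepro2.M9NoPocketDefs
import Summits.Ventures.PercRepro2.M9Unreached
import Summits.Ventures.PercRepro2.M9GeneralDSplit
import Summits.Ventures.PercRepro2.M9ReachedSum
import Summits.Ventures.PercRepro2.M9FourParts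

/-!
# The reached part and the `d`-star fibres (blind cell PercRepro2, p3 g30, 2026-08-28;
`proofs/P3-HDR.md` §9(c), §14)

`dSignSum = N + R` with `N = unreachedSum ≤ 0` (kernel) and `R = reachedAllSum =
Σ_{Sep ∧ DOne ∧ d reached} σ_pq σ_rs = L_z + EX + HD`.  `starCoFibre ends d β` is the `d`-STAR
FIBRE of the record (§5): the colourings agreeing with `β` OFF the star of `d` (the star free, the
base fixed); the fibres partition the colourings and «`R ≤ 0` on every fibre» implies the
single-`d` statement (`dSignSum_nonpos_of_reachStar`).  CAUTION (§14, found right after filing):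
that hypothesis is FALSE — on `n = 8`, edges `36 46 27 73 45 50 51`, `p q r s d = 0 1 2 3 4`, the
fibre with base `Y`-edge `36` (the other base edges `W`) has `R = L_z + HD = +2`; per fibre `R`
is positive in 268 of 668 nonzero fibres of a local census.  With the opposite convention (the
star FIXED, the rest free — the co-fibres of §7) `L_z + HD ≤ 0` is census-true (REACH-star) but
`R` is not: `n = 10`, edges `26 46 37 47 25 53 49 90 48 81 42 91`, star `Y`-edges `46, 49`:
`R = EX = +1`.  The identities stand; the crux remains graph-level (⟦EXHD⟧,
`dSignSum_nonpos_of_exhd_one_free`).  Own work; std axioms.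
-/

namespace Summit.Ventures.PercRepro2

namespace NoPocket

open Finset Classical RegionHub OneColourSwitch SideSwitch TermSwitch

variable {V : Type*} {E : Type*}

section ReachStar

variable [Fintype V] [DecidableEq V] [Fintype E] [DecidableEq E] {ends : E → Sym2 V}
  {p q r s d : V}

/-- The reached part `R = Σ_{Sep ∧ DOne ∧ d reached} σ_pq σ_rs`. -/
noncomputable def reachedAllSum (ends : E → Sym2 V) (p q r s d : V) : ℤ :=
  ∑ ω : Config E, if sep2 ends p q r s ω ∧ DOne ends r s d ω ∧ Reached ends r s d ω then
    sigma ends ω p q * sigma ends ω r s else 0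

omit [Fintype V] [DecidableEq V] [Fintype E] [DecidableEq E] in
/-- The pointwise split of the single-`d` summand into the unreached and the reached term. -/
lemma dSign_term_split_reachedAll (ω : Config E) :
    (if sep2 ends p q r s ω ∧ DOne ends r s d ω then
        sigma ends ω p q * sigma ends ω r s else 0) =
      (if sep2 ends p q r s ω ∧ DOne ends r s d ω ∧
          (d ∉ K2 ends r s ω ∧ d ∉ M2 ends r s ω) then
        sigma ends ω p q * sigma ends ω r s else 0) +
      (if sep2 ends p q r s ω ∧ DOne ends r s d ω ∧ Reached ends r s d ω then
        sigma ends ω p q * sigma ends ω r s else 0) := by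
  by_cases h : sep2 ends p q r s ω ∧ DOne ends r s d ω
  · by_cases hR : Reached ends r s d ω
    · have hn : ¬ (d ∉ K2 ends r s ω ∧ d ∉ M2 ends r s ω) := by
        intro hn
        rcases Set.mem_union _ _ _ |>.1 hR with hK | hM
        · exact hn.1 hK
        · exact hn.2 hM
      rw [if_pos h, if_neg (fun h' => hn h'.2.2), if_pos ⟨h.1, h.2, hR⟩, zero_add]
    · have hn : d ∉ K2 ends r s ω ∧ d ∉ M2 ends r s ω :=
        ⟨fun hK => hR (Set.mem_union_left _ hK), fun hM => hR (Set.mem_union_right _ hM)⟩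
      rw [if_pos h, if_pos ⟨h.1, h.2, hn⟩, if_neg (fun h' => hR h'.2.2), add_zero]
  · rw [if_neg h, if_neg (fun h' => h ⟨h'.1, h'.2.1⟩), if_neg (fun h' => h ⟨h'.1, h'.2.1⟩),
      add_zero]

omit [Fintype V] [DecidableEq V] in
/-- **`dSignSum = N + R`.** -/
theorem dSignSum_eq_unreached_add_reachedAll :
    dSignSum ends p q r s d = unreachedSum ends p q r s d + reachedAllSum ends p q r s d := by
  unfold dSignSum unreachedSum reachedAllSum
  rw [← Finset.sum_add_distrib]
  exact Finset.sum_congr rfl fun ω _ => dSign_term_split_reachedAll ω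

omit [Fintype V] [DecidableEq V] in
/-- **`R = L_z + EX + HD`.** -/
theorem reachedAllSum_eq_three_parts :
    reachedAllSum ends p q r s d = cleanReachedSum ends p q r s d + exSum ends p q r s d +
      hdSum ends p q r s d := by
  have h1 := dSignSum_eq_unreached_add_reachedAll (ends := ends) (p := p) (q := q) (r := r) (s := s)
    (d := d)
  have h2 := dSignSum_eq_four_parts (ends := ends) (p := p) (q := q) (r := r) (s := s) (d := d)
  linarith

/-- **The single-`d` statement from `R ≤ 0`.** -/
theorem dSignSum_nonpos_of_reachedAll_nonpos (h : reachedAllSum ends p q r s d ≤ 0) :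
    dSignSum ends p q r s d ≤ 0 := by
  rw [dSignSum_eq_unreached_add_reachedAll]
  have h3 := unreachedSum_nonpos (ends := ends) (p := p) (q := q) (r := r) (s := s) (d := d)
  linarith

/-- The off-star normalisation of a colouring: the star of `d` reset to `false` (the base of the
`d`-star fibre). -/
def starReset (ends : E → Sym2 V) (d : V) (ω : Config E) : Config E :=
  fun e => if d ∈ ends e then false else ω e

/-- The `d`-star FIBRE of a base `β`: the colourings agreeing with `β` off the star of `d` (the
star free; empty unless `β` is off-star normalised).  Named `starCoFibre` at filing; it is the
fibre, not the co-fibre, of the record's convention — see the module docstring. -/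
def starCoFibre (ends : E → Sym2 V) (d : V) (β : Config E) : Finset (Config E) :=
  univ.filter (fun ω => starReset ends d ω = β)

omit [Fintype V] in
/-- The reached part is the sum of its `d`-star fibre parts. -/
theorem reachedAllSum_eq_sum_starCoFibre :
    reachedAllSum ends p q r s d = ∑ β : Config E, ∑ ω ∈ starCoFibre ends d β,
      (if sep2 ends p q r s ω ∧ DOne ends r s d ω ∧ Reached ends r s d ω then
        sigma ends ω p q * sigma ends ω r s else 0) := by
  unfold reachedAllSum starCoFibre
  exact (Finset.sum_fiberwise_of_maps_to (s := univ) (t := univ) (g := starReset ends d)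
    (fun _ _ => Finset.mem_univ _) _).symm

omit [Fintype V] in
/-- If the reached part is non-positive on every `d`-star fibre, it is non-positive (the
hypothesis is FALSE in general — see the module docstring; the lemma is an identity-level
reduction only). -/
theorem reachedAllSum_nonpos_of_reachStar
    (h : ∀ β : Config E, (∑ ω ∈ starCoFibre ends d β,
      (if sep2 ends p q r s ω ∧ DOne ends r s d ω ∧ Reached ends r s d ω then
        sigma ends ω p q * sigma ends ω r s else 0)) ≤ 0) :
    reachedAllSum ends p q r s d ≤ 0 := by
  rw [reachedAllSum_eq_sum_starCoFibre]
  exact Finset.sum_nonpos fun β _ => h β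

/-- «`R ≤ 0` on every `d`-star fibre» ⟹ the single-`d` statement (the hypothesis is FALSE in
general — see the module docstring). -/
theorem dSignSum_nonpos_of_reachStar
    (h : ∀ β : Config E, (∑ ω ∈ starCoFibre ends d β,
      (if sep2 ends p q r s ω ∧ DOne ends r s d ω ∧ Reached ends r s d ω then
        sigma ends ω p q * sigma ends ω r s else 0)) ≤ 0) :
    dSignSum ends p q r s d ≤ 0 :=
  dSignSum_nonpos_of_reachedAll_nonpos (reachedAllSum_nonpos_of_reachStar h)

end ReachStar

end NoPocket

end Summit.Ventures.PercRepro2
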